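import Summits.CriticalPhenomena.PercolationContinuityZ3.Theorems.PercNearOneGluingNoHeavyLowerTailSahiCTCLadderThreeRowThreeCaseI
import HarnessLib

/-!
# `NoHeavyLowerTail` (crux stmt-CriticalPhenomena-4575), P3 lane: the row `#dbl = 1` of `(L_3)` in the dense-triple regime

Support file (seat `prim-l12-p3`, gen 26; `--supports stmt-CriticalPhenomena-4575`).  Memo g26 §4.11.  For a profile `m = 2·1_d + 1_T`
(`#dbl m = 1`, `τ = #T`) the cubes of `[m](e_3·H)` are the 3-live RESTRICTIONS `κ(∅, d ∪ T∖Q)` (`Q ⊆ T` a pair) and the 2-live LINKS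
`κ({d}, T∖E)` (`E ⊆ T` a triple); the charge is `cH(3,τ−1)·g + cH(2,τ−3)·ε` with `g = #{Q : d+Q ∈ 𝒳∩𝒵}`, `ε = #{E ⊆ T : E ∈ 𝒳∩𝒵}`
(`coeff_chargeT_rowOne_le`, `cubes_le_coeff_ee_mul_harris_rowOne`).  Splitting each restriction cube at `d` (`kap_rec`) and bounding the three
resulting families of cubes by t-DENSITY (`…KleitmanDensityT`) proves the row whenever the common triples are at least as dense as the common
`d`-pairs: **`coeff_ladder_three_rowOne_nonneg_of_dense`**: `3ε ≥ (τ−2)g`, `τ ≥ 7` ⇒ `[m] L_3 ≥ 0` (exact at `H_3`).  Nothing is asserted about the crux.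
-/

namespace Summit.CriticalPhenomena.PercolationContinuityZ3.Theorems.SahiCTCForms

open Finset MvPolynomial SahiCTCGenFun SahiCTCWeightedLYM

variable {α : Type*} [DecidableEq α] [Fintype α]

section RowOne
variable {𝒳 𝒵 : Finset (Finset α)}

omit [DecidableEq α] [Fintype α] in
/-- In the row `#dbl = 1`, `dbl m = {d}` for the doubled point `d`. [this work] -/
theorem dbl_eq_singleton_of_card {m : α →₀ ℕ} (hD : #(dbl m) = 1) {d : α} (hd : d ∈ dbl m) : dbl m = {d} := by
  obtain ⟨x, hx⟩ := card_eq_one.1 hD; rw [hx] at hd ⊢; rw [mem_singleton.1 hd]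

/-- The restriction cube at a pair `Q ⊆ T`: `[m − 1_{d+Q}] H = κ(∅, d ∪ (T∖Q))`. [this work] -/
theorem coeff_harris_cube_rowOne_R {m : α →₀ ℕ} (hm : ∀ i, m i ≤ 2) (hD : #(dbl m) = 1) {d : α} (hd : d ∈ dbl m) {Q : Finset α}
    (hQ : Q ⊆ lev m 1) :
    (PiP * gf (𝒳 ∩ 𝒵) - gf 𝒳 * gf 𝒵).coeff (m - ind (insert d Q)) = kap 𝒳 𝒵 ∅ (insert d (lev m 1 \ Q)) := by
  rw [coeff_harrisForm_eq_kap _ _ (sub_ind_le_two_of_le_two hm _), dbl_sub_ind_of_le_two hm, sgl_sub_ind_of_le_two hm,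
    dbl_eq_singleton_of_card hD hd]
  have hdT : d ∉ lev m 1 := fun h => disjoint_left.1 (disjoint_dbl_lev_one m) hd h
  have hQD : d ∉ Q := fun h => hdT (hQ h)
  congr 1
  · ext i; simp only [mem_sdiff, mem_singleton, mem_insert, notMem_empty, iff_false, not_and, not_not]
    intro h; exact Or.inl h
  · ext i; simp only [mem_union, mem_inter, mem_singleton, mem_insert, mem_sdiff]
    constructor
    · rintro (⟨rfl, _⟩ | ⟨hi, hni⟩)
      · exact Or.inl rfl
      · exact Or.inr ⟨hi, fun h => hni (Or.inr h)⟩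
    · rintro (rfl | ⟨hi, hiQ⟩)
      · exact Or.inl ⟨rfl, Or.inl rfl⟩
      · exact Or.inr ⟨hi, fun h => h.elim (fun h => hdT (h ▸ hi)) hiQ⟩

/-- The link cube at a triple `E ⊆ T`: `[m − 1_E] H = κ({d}, T∖E)`. [this work] -/
theorem coeff_harris_cube_rowOne_L {m : α →₀ ℕ} (hm : ∀ i, m i ≤ 2) (hD : #(dbl m) = 1) {d : α} (hd : d ∈ dbl m) {E : Finset α}
    (hE : E ⊆ lev m 1) :
    (PiP * gf (𝒳 ∩ 𝒵) - gf 𝒳 * gf 𝒵).coeff (m - ind E) = kap 𝒳 𝒵 {d} (lev m 1 \ E) := by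
  rw [coeff_harrisForm_eq_kap _ _ (sub_ind_le_two_of_le_two hm _), dbl_sub_ind_of_le_two hm, sgl_sub_ind_of_le_two hm,
    dbl_eq_singleton_of_card hD hd]
  have hdT : d ∉ lev m 1 := fun h => disjoint_left.1 (disjoint_dbl_lev_one m) hd h
  have hdE : d ∉ E := fun h => hdT (hE h)
  congr 1
  · ext i; simp only [mem_sdiff, mem_singleton]; constructor
    · exact fun h => h.1
    · rintro rfl; exact ⟨rfl, hdE⟩
  · rw [show ({d} : Finset α) ∩ E = ∅ from disjoint_iff_inter_eq_empty.1 (disjoint_singleton_left.2 hdE), empty_union]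

/-- **Cubes of the row `#dbl = 1`**: `Σ_Q κ(∅, d ∪ T∖Q) + Σ_E κ({d}, T∖E) ≤ [m](e_3·H)`. [this work] -/
theorem cubes_le_coeff_ee_mul_harris_rowOne (h𝒳 : IsUpperSet (𝒳 : Set (Finset α))) (h𝒵 : IsUpperSet (𝒵 : Set (Finset α)))
    {m : α →₀ ℕ} (hm : ∀ i, m i ≤ 2) (hD : #(dbl m) = 1) {d : α} (hd : d ∈ dbl m) :
    ∑ Q ∈ (lev m 1).powersetCard 2, kap 𝒳 𝒵 ∅ (insert d (lev m 1 \ Q)) + ∑ E ∈ (lev m 1).powersetCard 3, kap 𝒳 𝒵 {d} (lev m 1 \ E) ≤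
      (ee 3 * (PiP * gf (𝒳 ∩ 𝒵) - gf 𝒳 * gf 𝒵)).coeff m := by
  have hdT : d ∉ lev m 1 := fun h => disjoint_left.1 (disjoint_dbl_lev_one m) hd h
  have hDeq := dbl_eq_singleton_of_card hD hd
  set S₁ := ((lev m 1).powersetCard 2).image fun Q => insert d Q
  set S₂ := (lev m 1).powersetCard 3
  have hadm : S₁ ∪ S₂ ⊆ (bySize (· = 3) : Finset (Finset α)).filter fun E => ind E ≤ m := by
    intro E hE
    rw [mem_filter, bySize, mem_filter, SahiAllButC.ind_le_iff_subset_support, support_eq_dbl_union_lev hm, hDeq]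
    refine ⟨⟨mem_powerset.2 (subset_univ _), ?_⟩, ?_⟩
    · rcases mem_union.1 hE with hE | hE
      · obtain ⟨Q, hQ, rfl⟩ := mem_image.1 hE
        obtain ⟨hQT, hQ2⟩ := mem_powersetCard.1 hQ
        rw [card_insert_of_notMem (fun h => hdT (hQT h)), hQ2]
      · exact (mem_powersetCard.1 hE).2
    · rcases mem_union.1 hE with hE | hE
      · obtain ⟨Q, hQ, rfl⟩ := mem_image.1 hE
        exact insert_subset (mem_union_left _ (mem_singleton_self d)) ((mem_powersetCard.1 hQ).1.trans subset_union_right)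
      · exact (mem_powersetCard.1 hE).1.trans subset_union_right
  have hdisj : Disjoint S₁ S₂ := disjoint_left.2 fun E h1 h2 => by
    obtain ⟨Q, _, rfl⟩ := mem_image.1 h1
    exact hdT ((mem_powersetCard.1 h2).1 (mem_insert_self d Q))
  have hinj : Set.InjOn (fun Q : Finset α => insert d Q) ↑((lev m 1).powersetCard 2) := fun Q hQ Q' hQ' h => by
    have hQ := (mem_powersetCard.1 (Finset.mem_coe.1 hQ)).1
    have hQ' := (mem_powersetCard.1 (Finset.mem_coe.1 hQ')).1
    have := congrArg (fun s => Finset.erase s d) h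
    simp only [erase_insert (fun h => hdT (hQ h)), erase_insert (fun h => hdT (hQ' h))] at this
    exact this
  have hsur := sum_le_coeff_ee_mul_harris h𝒳 h𝒵 3 m hadm
  rw [sum_union hdisj, sum_image hinj,
    sum_congr rfl fun Q hQ => coeff_harris_cube_rowOne_R hm hD hd (mem_powersetCard.1 hQ).1,
    sum_congr rfl fun E hE => coeff_harris_cube_rowOne_L hm hD hd (mem_powersetCard.1 hE).1] at hsur
  exact hsur

/-- **Charge of the row `#dbl = 1`**: `[m](Θ_2·e_{≥3}·GF(W)) ≤ cH(3,τ−1)·#{Q ⊆ T pair : d+Q ∈ W} + cH(2,τ−3)·#{E ⊆ T triple : E ∈ W}`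
for a family `W` of 3-sets (`τ ≥ 4`). [this work] -/
theorem coeff_chargeT_rowOne_le {m : α →₀ ℕ} (hm : ∀ i, m i ≤ 2) (hD : #(dbl m) = 1) {d : α} (hd : d ∈ dbl m) (hτ : 4 ≤ #(lev m 1))
    (W : Finset (Finset α)) (hW : ∀ w ∈ W, #w = 3) :
    (gf (bySize (· ≤ 3 - 1) : Finset (Finset α)) * gf (bySize (3 ≤ ·) : Finset (Finset α)) * gf W).coeff m ≤
      (cH 3 (#(lev m 1) - 1) : ℤ) * #(((lev m 1).powersetCard 2).filter fun Q => insert d Q ∈ W) +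
        (cH 2 (#(lev m 1) - 3) : ℤ) * #(((lev m 1).powersetCard 3).filter fun E => E ∈ W) := by
  rw [coeff_chargeT_eq_sum]
  have hdT : d ∉ lev m 1 := fun h => disjoint_left.1 (disjoint_dbl_lev_one m) hd h
  have hDeq := dbl_eq_singleton_of_card hD hd
  set Wm := W.filter fun w => ind w ≤ m
  have hsuppw : ∀ w ∈ Wm, w ⊆ insert d (lev m 1) := fun w hw => by
    have := (SahiAllButC.ind_le_iff_subset_support _ _).1 (mem_filter.1 hw).2
    rw [support_eq_dbl_union_lev hm, hDeq] at this
    rw [insert_eq]; exact this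
  have hval : ∀ w ∈ Wm, (gf (bySize (· ≤ 3 - 1) : Finset (Finset α)) * gf (bySize (3 ≤ ·) : Finset (Finset α))).coeff (m - ind w) =
      if d ∈ w then (cH 3 (#(lev m 1) - 1) : ℤ) else cH 2 (#(lev m 1) - 3) := fun w hw => by
    obtain ⟨hwW, hwm⟩ := mem_filter.1 hw
    have hwt := hW w hwW
    rw [coeff_thetaT_mul_atLeastT_eq_cH (by norm_num) (sub_ind_le_two_of_le_two hm w), dbl_sub_ind_of_le_two hm, sgl_sub_ind_of_le_two hm,
      hDeq]
    have hwT : #(lev m 1 \ w) + #(lev m 1 ∩ w) = #(lev m 1) := card_sdiff_add_card_inter _ _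
    split_ifs with hdw
    · have h1 : ({d} : Finset α) ∩ w = {d} := inter_eq_left.2 (singleton_subset_iff.2 hdw)
      have h2 : ({d} : Finset α) \ w = ∅ := sdiff_eq_empty_iff_subset.2 (singleton_subset_iff.2 hdw)
      have h3 : #(lev m 1 ∩ w) = 2 := by
        have : #(insert d (lev m 1) ∩ w) = 3 := by rw [inter_eq_right.2 (hsuppw w hw), hwt]
        rw [insert_inter_of_mem hdw, card_insert_of_notMem (fun h => hdT (mem_inter.1 h).1)] at this; omega
      rw [h1, h2, card_empty, card_union_of_disjoint (disjoint_singleton_left.2 fun h => hdT (mem_sdiff.1 h).1), card_singleton]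
      congr 2; omega
    · have h1 : ({d} : Finset α) ∩ w = ∅ := disjoint_iff_inter_eq_empty.1 (disjoint_singleton_left.2 hdw)
      have h2 : ({d} : Finset α) \ w = {d} := sdiff_eq_self_of_disjoint (disjoint_singleton_left.2 hdw)
      have h3 : #(lev m 1 ∩ w) = 3 := by
        have hwT' : w ⊆ lev m 1 := fun i hi => by
          have := hsuppw w hw hi; rcases mem_insert.1 this with rfl | h
          · exact absurd hi hdw
          · exact h
        rw [inter_eq_right.2 hwT', hwt]
      rw [h1, h2, card_singleton, empty_union]
      congr 2; omega
  rw [sum_congr rfl hval, sum_ite, sum_const, sum_const, nsmul_eq_mul, nsmul_eq_mul]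
  have hc1 : #(Wm.filter fun w => d ∈ w) ≤ #(((lev m 1).powersetCard 2).filter fun Q => insert d Q ∈ W) := by
    refine card_le_card_of_injOn (fun w => w.erase d) (fun w hw => ?_) (fun w hw w' hw' h => ?_)
    · obtain ⟨hw, hdw⟩ := mem_filter.1 hw
      have hwt := hW w (mem_filter.1 hw).1
      refine Finset.mem_coe.2 (mem_filter.2 ⟨mem_powersetCard.2 ⟨fun i hi => ?_, by rw [card_erase_of_mem hdw, hwt]⟩, ?_⟩)
      · have := hsuppw w hw (mem_of_mem_erase hi)
        rcases mem_insert.1 this with h | h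
        · exact absurd h (ne_of_mem_erase hi)
        · exact h
      · rw [insert_erase hdw]; exact (mem_filter.1 hw).1
    · have hdw := (mem_filter.1 (Finset.mem_coe.1 hw)).2
      have hdw' := (mem_filter.1 (Finset.mem_coe.1 hw')).2
      have := congrArg (insert d) h
      simp only [insert_erase hdw, insert_erase hdw'] at this; exact this
  have hc2 : #(Wm.filter fun w => d ∉ w) ≤ #(((lev m 1).powersetCard 3).filter fun E => E ∈ W) := by
    refine card_le_card fun w hw => ?_
    obtain ⟨hw, hdw⟩ := mem_filter.1 hw
    refine mem_filter.2 ⟨mem_powersetCard.2 ⟨fun i hi => ?_, hW w (mem_filter.1 hw).1⟩, (mem_filter.1 hw).1⟩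
    have := hsuppw w hw hi; rcases mem_insert.1 this with rfl | h
    · exact absurd hi hdw
    · exact h
  have hc1' : (#(Wm.filter fun w => d ∈ w) : ℤ) ≤ #(((lev m 1).powersetCard 2).filter fun Q => insert d Q ∈ W) := by exact_mod_cast hc1
  have hc2' : (#(Wm.filter fun w => d ∉ w) : ℤ) ≤ #(((lev m 1).powersetCard 3).filter fun E => E ∈ W) := by exact_mod_cast hc2
  have hp1 : (0 : ℤ) ≤ cH 3 (#(lev m 1) - 1) := Nat.cast_nonneg _
  have hp2 : (0 : ℤ) ≤ cH 2 (#(lev m 1) - 3) := Nat.cast_nonneg _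
  nlinarith

omit [Fintype α] in
/-- Pairs avoiding a fixed subset: `{Q ∈ binom(T,b) : w ⊆ T∖Q} = binom(T∖w, b)`. [folklore] -/
theorem filter_powersetCard_subset_sdiff {T w : Finset α} (hw : w ⊆ T) (b : ℕ) :
    ((T.powersetCard b).filter fun Q => w ⊆ T \ Q) = (T \ w).powersetCard b := by
  ext Q; simp only [mem_filter, mem_powersetCard]
  constructor
  · rintro ⟨⟨hQT, hQb⟩, hwQ⟩
    exact ⟨fun i hi => mem_sdiff.2 ⟨hQT hi, fun hiw => (mem_sdiff.1 (hwQ hiw)).2 hi⟩, hQb⟩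
  · rintro ⟨hQ, hQb⟩
    exact ⟨⟨fun i hi => (mem_sdiff.1 (hQ hi)).1, hQb⟩, fun i hiw => mem_sdiff.2 ⟨hw hiw, fun hiQ => (mem_sdiff.1 (hQ hiQ)).2 hiw⟩⟩

omit [Fintype α] in
/-- Double counting of (cube, common set) incidences: for a family `A ⊆ binom(T,a)`,
`Σ_{Q ∈ binom(T,b)} #{w ∈ A : w ⊆ T∖Q} = #A · C(#T − a, b)`. [folklore] -/
theorem sum_card_filter_subset_sdiff {T : Finset α} {A : Finset (Finset α)} {a : ℕ} (hA : ∀ w ∈ A, w ⊆ T ∧ #w = a) (b : ℕ) :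
    ∑ Q ∈ T.powersetCard b, #(A.filter fun w => w ⊆ T \ Q) = #A * (#T - a).choose b := by
  have h := sum_card_bipartiteAbove_eq_sum_card_bipartiteBelow (s := T.powersetCard b) (t := A) (r := fun Q w => w ⊆ T \ Q)
  simp only [bipartiteAbove, bipartiteBelow] at h
  rw [h]
  have : ∀ w ∈ A, #((T.powersetCard b).filter fun Q => w ⊆ T \ Q) = (#T - a).choose b := fun w hw => by
    rw [filter_powersetCard_subset_sdiff (hA w hw).1, card_powersetCard, card_sdiff_of_subset (hA w hw).1, (hA w hw).2]
  rw [sum_congr rfl this, sum_const, smul_eq_mul]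

omit [Fintype α] in
/-- One PEEL step at a point outside the free set: `κ(D, s') + κ(D + v, s') ≤ κ(D, s' + v)`. [this work] -/
theorem kap_add_kap_le_kap_insert (h𝒳 : IsUpperSet (𝒳 : Set (Finset α))) (h𝒵 : IsUpperSet (𝒵 : Set (Finset α))) {D s' : Finset α}
    {v : α} (hvD : v ∉ D) (hvs : v ∉ s') : kap 𝒳 𝒵 D s' + kap 𝒳 𝒵 (insert v D) s' ≤ kap 𝒳 𝒵 D (insert v s') := by
  have hrec := kap_rec (𝒳 := 𝒳) (𝒵 := 𝒵) (D := D) (s := insert v s') h𝒳 h𝒵 (mem_insert_self v s') hvD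
  rw [erase_insert hvs] at hrec
  have h0 : (0 : ℤ) ≤ #((tr 𝒳 (insert v D) s' \ tr 𝒳 D s').filter fun R => s' \ R ∈ tr 𝒵 (insert v D) s' ∧ s' \ R ∉ tr 𝒵 D s') :=
    Nat.cast_nonneg _
  linarith

/-- The integer arithmetic of the dense-triple regime (certificate `(n²+3n+6)(3ε − n g) ≥ 0`). [this work] -/
theorem rowOne_dense_arith {nz A B Cc R g ε gW eW Γ c2 c2' c3 cH3 : ℤ} (hnz5 : 5 ≤ nz)
    (sA : (nz + 1) * (g * c2) ≤ c2 * A) (sB : cH3 * (ε * c2') ≤ c3 * B) (sC : nz * (g * c3) ≤ c2' * Cc)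
    (e2 : c2 * 2 = nz * (nz - 1)) (e2' : c2' * 2 = (nz - 1) * (nz - 2)) (e3 : c3 * 3 = c2' * nz)
    (ecH3 : 2 * cH3 = nz ^ 2 + nz + 2) (ecH3' : 2 * Γ = (nz + 1) ^ 2 + (nz + 1) + 2) (hg' : gW ≤ g) (hε' : eW ≤ ε)
    (heW : 0 ≤ eW) (hdense' : nz * g ≤ 3 * ε) (hsplit' : B + A ≤ R) : Γ * gW + nz * eW ≤ R + Cc := by
  have hc2pos : 0 < c2 := by
    have h : (0 : ℤ) < nz * (nz - 1) := mul_pos (by linarith) (by linarith)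
    linarith [e2]
  have hc2'pos : 0 < c2' := by
    have h : (0 : ℤ) < (nz - 1) * (nz - 2) := mul_pos (by linarith) (by linarith)
    linarith [e2']
  have hA' : (nz + 1) * g ≤ A := le_of_mul_le_mul_left (by nlinarith [sA]) hc2pos
  have hB' : 3 * cH3 * ε ≤ nz * B := by
    have h1 : 3 * (cH3 * (ε * c2')) ≤ 3 * (c3 * B) := by linarith [sB]
    have h2 : c3 * 3 * B = c2' * nz * B := by rw [e3]
    refine le_of_mul_le_mul_left ?_ hc2'pos
    linarith [h1, h2]
  have hC' : nz ^ 2 * g ≤ 3 * Cc := by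
    have h1 : 3 * (nz * (g * c3)) ≤ 3 * (c2' * Cc) := by linarith [sC]
    have h2 : c3 * 3 * (nz * g) = c2' * nz * (nz * g) := by rw [e3]
    refine le_of_mul_le_mul_left ?_ hc2'pos
    nlinarith [h1, h2]
  have hnzpos : (0 : ℤ) < nz := by linarith
  have key : nz * (2 * (Γ * g + nz * ε)) ≤ nz * (2 * (A + B + Cc)) := by
    have hprod : 0 ≤ (nz ^ 2 + 3 * nz + 6) * (3 * ε - nz * g) := mul_nonneg (by nlinarith) (by linarith)
    nlinarith [hA', hB', hC', hprod, ecH3, ecH3']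
  have key' := le_of_mul_le_mul_left key hnzpos
  have hΓ0 : 0 ≤ Γ := by nlinarith [ecH3']
  nlinarith [key', hsplit', hg', hε', hΓ0, hnz5, mul_le_mul_of_nonneg_left hg' hΓ0]

/-- **Row `#dbl = 1` of `(L_3)` in the dense-triple regime** (memo §4.11): if `3·ε ≥ (τ−2)·g` for the numbers `ε` of common triples
inside `T` and `g` of common pairs `Q` with `d + Q` common, and `τ ≥ 7`, then `[m] L_3 ≥ 0`. [this work] -/
theorem coeff_ladder_three_rowOne_nonneg_of_dense (h𝒳 : IsUpperSet (𝒳 : Set (Finset α))) (h𝒵 : IsUpperSet (𝒵 : Set (Finset α)))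
    (hX3 : ∀ S ∈ 𝒳, 3 ≤ #S) (hZ3 : ∀ S ∈ 𝒵, 3 ≤ #S) {m : α →₀ ℕ} (hm : ∀ i, m i ≤ 2) (hD : #(dbl m) = 1) {d : α} (hd : d ∈ dbl m)
    (hτ : 7 ≤ #(lev m 1))
    (hdense : (#(lev m 1) - 2) * #(((lev m 1).powersetCard 2).filter fun Q => insert d Q ∈ 𝒳 ∧ insert d Q ∈ 𝒵) ≤
      3 * #(((lev m 1).powersetCard 3).filter fun E => E ∈ 𝒳 ∧ E ∈ 𝒵)) :
    0 ≤ (ee 3 * (PiP * gf (𝒳 ∩ 𝒵) - gf 𝒳 * gf 𝒵) -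
      gf (bySize (· ≤ 3 - 1) : Finset (Finset α)) * gf (bySize (3 ≤ ·) : Finset (Finset α)) *
        gf ((𝒳 ∩ 𝒵).filter fun S => #S = 3)).coeff m := by
  set W := (𝒳 ∩ 𝒵).filter fun S => #S = 3 with hWdef
  have hW3 : ∀ w ∈ W, #w = 3 := fun w hw => (mem_filter.1 hw).2
  have hWsub : ∀ w ∈ W, w ∈ 𝒳 ∧ w ∈ 𝒵 := fun w hw => mem_inter.1 (mem_filter.1 hw).1
  have hdT : d ∉ lev m 1 := fun h => disjoint_left.1 (disjoint_dbl_lev_one m) hd h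
  set GT := ((lev m 1).powersetCard 2).filter fun Q => insert d Q ∈ 𝒳 ∧ insert d Q ∈ 𝒵 with hGT
  set ET := ((lev m 1).powersetCard 3).filter fun E => E ∈ 𝒳 ∧ E ∈ 𝒵 with hET
  rw [coeff_sub, sub_nonneg]
  refine (coeff_chargeT_rowOne_le hm hD hd (by omega) W hW3).trans (le_trans ?_ (cubes_le_coeff_ee_mul_harris_rowOne h𝒳 h𝒵 hm hD hd))
  -- the charge counts are at most g and ε
  have hg : #(((lev m 1).powersetCard 2).filter fun Q => insert d Q ∈ W) ≤ #GT :=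
    card_le_card fun Q hQ => mem_filter.2 ⟨(mem_filter.1 hQ).1, hWsub _ (mem_filter.1 hQ).2⟩
  have hε : #(((lev m 1).powersetCard 3).filter fun E => E ∈ W) ≤ #ET :=
    card_le_card fun E hE => mem_filter.2 ⟨(mem_filter.1 hE).1, hWsub _ (mem_filter.1 hE).2⟩
  -- split the restriction cubes at d
  have hsplit : ∀ Q ∈ (lev m 1).powersetCard 2,
      kap 𝒳 𝒵 ∅ (lev m 1 \ Q) + kap 𝒳 𝒵 {d} (lev m 1 \ Q) ≤ kap 𝒳 𝒵 ∅ (insert d (lev m 1 \ Q)) := fun Q hQ => by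
    have := kap_add_kap_le_kap_insert h𝒳 h𝒵 (D := (∅ : Finset α)) (s' := lev m 1 \ Q) (notMem_empty d)
      (fun h => hdT (mem_sdiff.1 h).1)
    rwa [insert_empty_eq] at this
  -- liveness of the traces
  have hl3X : ∀ s, ∀ U ∈ tr 𝒳 ∅ s, 3 ≤ #U := fun s U hU => hX3 U (by simpa using (mem_tr.1 hU).2)
  have hl3Z : ∀ s, ∀ U ∈ tr 𝒵 ∅ s, 3 ≤ #U := fun s U hU => hZ3 U (by simpa using (mem_tr.1 hU).2)
  have hl2X : ∀ s, ∀ U ∈ tr 𝒳 {d} s, 2 ≤ #U := fun s U hU => by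
    have := hX3 _ (mem_tr.1 hU).2; have := card_union_le ({d} : Finset α) U; rw [card_singleton] at this; omega
  have hl2Z : ∀ s, ∀ U ∈ tr 𝒵 {d} s, 2 ≤ #U := fun s U hU => by
    have := hZ3 _ (mem_tr.1 hU).2; have := card_union_le ({d} : Finset α) U; rw [card_singleton] at this; omega
  -- common sets of the traces are the common pairs/triples inside the cube
  have hcs2 : ∀ s, s ⊆ lev m 1 → csetsT 𝒳 𝒵 {d} s 2 = GT.filter fun w => w ⊆ s := fun s hs => by
    ext w; simp only [csetsT, GT, mem_filter, mem_powersetCard, insert_eq]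
    constructor
    · rintro ⟨⟨hws, hw2⟩, hX, hZ⟩; exact ⟨⟨⟨hws.trans hs, hw2⟩, hX, hZ⟩, hws⟩
    · rintro ⟨⟨⟨_, hw2⟩, hX, hZ⟩, hws⟩; exact ⟨⟨hws, hw2⟩, hX, hZ⟩
  have hcs3 : ∀ s, s ⊆ lev m 1 → csetsT 𝒳 𝒵 ∅ s 3 = ET.filter fun w => w ⊆ s := fun s hs => by
    ext w; simp only [csetsT, ET, mem_filter, mem_powersetCard, empty_union]
    constructor
    · rintro ⟨⟨hws, hw3⟩, hX, hZ⟩; exact ⟨⟨⟨hws.trans hs, hw3⟩, hX, hZ⟩, hws⟩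
    · rintro ⟨⟨⟨_, hw3⟩, hX, hZ⟩, hws⟩; exact ⟨⟨hws, hw3⟩, hX, hZ⟩
  -- the size n = τ − 2 of the Q-cubes
  obtain ⟨n, hn⟩ : ∃ n : ℕ, #(lev m 1) = n + 2 := ⟨#(lev m 1) - 2, by omega⟩
  have hn5 : 5 ≤ n := by omega
  have hnT : ∀ Q ∈ (lev m 1).powersetCard 2, #(lev m 1 \ Q) = n := fun Q hQ => by
    rw [card_sdiff_of_subset (mem_powersetCard.1 hQ).1, (mem_powersetCard.1 hQ).2]; omega
  have hnE : ∀ E ∈ (lev m 1).powersetCard 3, #(lev m 1 \ E) = n - 1 := fun E hE => by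
    rw [card_sdiff_of_subset (mem_powersetCard.1 hE).1, (mem_powersetCard.1 hE).2]; omega
  have hcH2 : ∀ k, 3 ≤ k → cH 2 k = k + 1 := fun k hk => by
    unfold cH; rw [show min 2 (k + 1 - 2) = 2 from by omega]; simp [sum_range_succ]; omega
  -- (a) the link Q-cubes, (b) the deletion Q-cubes, (c) the link E-cubes — all by t-DENSITY
  have ha : ∀ Q ∈ (lev m 1).powersetCard 2,
      (((n + 1 : ℕ) : ℤ)) * #(GT.filter fun w => w ⊆ lev m 1 \ Q) ≤ (n.choose 2 : ℤ) * kap 𝒳 𝒵 {d} (lev m 1 \ Q) := fun Q hQ => by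
    have h := densityT_le_kap h𝒳 h𝒵 2 n {d} (lev m 1 \ Q) (disjoint_singleton_left.2 fun h => hdT (mem_sdiff.1 h).1) (hnT Q hQ)
      (hl2X _) (hl2Z _)
    rw [hcs2 _ sdiff_subset, hcH2 n (by omega)] at h; exact h
  have hb : ∀ Q ∈ (lev m 1).powersetCard 2,
      (cH 3 n : ℤ) * #(ET.filter fun w => w ⊆ lev m 1 \ Q) ≤ (n.choose 3 : ℤ) * kap 𝒳 𝒵 ∅ (lev m 1 \ Q) := fun Q hQ => by
    have h := densityT_le_kap h𝒳 h𝒵 3 n ∅ (lev m 1 \ Q) (disjoint_empty_left _) (hnT Q hQ) (hl3X _) (hl3Z _)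
    rw [hcs3 _ sdiff_subset] at h; exact h
  have hc : ∀ E ∈ (lev m 1).powersetCard 3,
      (((n : ℕ) : ℤ)) * #(GT.filter fun w => w ⊆ lev m 1 \ E) ≤ ((n - 1).choose 2 : ℤ) * kap 𝒳 𝒵 {d} (lev m 1 \ E) := fun E hE => by
    have h := densityT_le_kap h𝒳 h𝒵 2 (n - 1) {d} (lev m 1 \ E) (disjoint_singleton_left.2 fun h => hdT (mem_sdiff.1 h).1) (hnE E hE)
      (hl2X _) (hl2Z _)
    rw [hcs2 _ sdiff_subset, hcH2 (n - 1) (by omega), show n - 1 + 1 = n from by omega] at h; exact h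
  -- double counting
  have hGT' : ∀ w ∈ GT, w ⊆ lev m 1 ∧ #w = 2 := fun w hw => mem_powersetCard.1 (mem_filter.1 hw).1
  have hET' : ∀ w ∈ ET, w ⊆ lev m 1 ∧ #w = 3 := fun w hw => mem_powersetCard.1 (mem_filter.1 hw).1
  have sA := sum_le_sum ha
  have sB := sum_le_sum hb
  have sC := sum_le_sum hc
  rw [← mul_sum, ← mul_sum] at sA sB sC
  have dA : ∑ Q ∈ (lev m 1).powersetCard 2, (#(GT.filter fun w => w ⊆ lev m 1 \ Q) : ℤ) = #GT * (n.choose 2 : ℕ) := by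
    have := sum_card_filter_subset_sdiff hGT' 2; rw [hn, show n + 2 - 2 = n from by omega] at this; exact_mod_cast this
  have dB : ∑ Q ∈ (lev m 1).powersetCard 2, (#(ET.filter fun w => w ⊆ lev m 1 \ Q) : ℤ) = #ET * ((n - 1).choose 2 : ℕ) := by
    have := sum_card_filter_subset_sdiff hET' 2; rw [hn, show n + 2 - 3 = n - 1 from by omega] at this; exact_mod_cast this
  have dC : ∑ E ∈ (lev m 1).powersetCard 3, (#(GT.filter fun w => w ⊆ lev m 1 \ E) : ℤ) = #GT * (n.choose 3 : ℕ) := by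
    have := sum_card_filter_subset_sdiff hGT' 3; rw [hn, show n + 2 - 2 = n from by omega] at this; exact_mod_cast this
  rw [dA] at sA; rw [dB] at sB; rw [dC] at sC
  -- binomial identities
  have e2 : ((n.choose 2 : ℕ) : ℤ) * 2 = (n : ℤ) * (n - 1) := by
    have h2 : n.choose 2 * 2 = n * (n - 1) := by rw [Nat.choose_two_right]; exact Nat.div_mul_cancel (Nat.even_mul_pred_self n).two_dvd
    have := congrArg (fun k : ℕ => (k : ℤ)) h2; push_cast [Nat.cast_sub (by omega : 1 ≤ n)] at this; linarith
  have e2' : (((n - 1).choose 2 : ℕ) : ℤ) * 2 = ((n : ℤ) - 1) * (n - 2) := by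
    have h2 : (n - 1).choose 2 * 2 = (n - 1) * (n - 1 - 1) := by
      rw [Nat.choose_two_right]; exact Nat.div_mul_cancel (Nat.even_mul_pred_self _).two_dvd
    have := congrArg (fun k : ℕ => (k : ℤ)) h2
    push_cast [Nat.cast_sub (by omega : 1 ≤ n), Nat.cast_sub (by omega : 1 ≤ n - 1)] at this
    nlinarith [this]
  have e3 : ((n.choose 3 : ℕ) : ℤ) * 3 = (((n - 1).choose 2 : ℕ) : ℤ) * n := by
    have h3 : n.choose 3 * 3 = (n - 1).choose 2 * n := by
      have := Nat.add_one_mul_choose_eq (n - 1) 2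
      rw [show n - 1 + 1 = n from by omega] at this
      linarith
    exact_mod_cast h3
  have ecH3 : 2 * (cH 3 n : ℤ) = (n : ℤ) ^ 2 + n + 2 := two_mul_cH_three hn5
  have ecH3' : 2 * (cH 3 (#(lev m 1) - 1) : ℤ) = ((n : ℤ) + 1) ^ 2 + (n + 1) + 2 := by
    rw [hn, show n + 2 - 1 = n + 1 from by omega]; have := two_mul_cH_three (n := n + 1) (by omega); push_cast at this; linarith
  have ecH2 : (cH 2 (#(lev m 1) - 3) : ℤ) = n := by
    rw [hn, show n + 2 - 3 = n - 1 from by omega, hcH2 (n - 1) (by omega)]; push_cast [Nat.cast_sub (by omega : 1 ≤ n)]; ring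
  have hg' : (#(((lev m 1).powersetCard 2).filter fun Q => insert d Q ∈ W) : ℤ) ≤ #GT := by exact_mod_cast hg
  have hε' : (#(((lev m 1).powersetCard 3).filter fun E => E ∈ W) : ℤ) ≤ #ET := by exact_mod_cast hε
  have hdense' : (n : ℤ) * #GT ≤ 3 * #ET := by
    have := hdense; rw [hn, show n + 2 - 2 = n from by omega] at this; exact_mod_cast this
  have hsplit' := sum_le_sum hsplit
  rw [sum_add_distrib] at hsplit'
  -- opaque names for the three cube sums
  generalize hA : ∑ Q ∈ (lev m 1).powersetCard 2, kap 𝒳 𝒵 {d} (lev m 1 \ Q) = A at sA hsplit'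
  generalize hB : ∑ Q ∈ (lev m 1).powersetCard 2, kap 𝒳 𝒵 ∅ (lev m 1 \ Q) = B at sB hsplit'
  generalize hC : ∑ E ∈ (lev m 1).powersetCard 3, kap 𝒳 𝒵 {d} (lev m 1 \ E) = Cc at sC ⊢
  generalize hR : ∑ Q ∈ (lev m 1).powersetCard 2, kap 𝒳 𝒵 ∅ (insert d (lev m 1 \ Q)) = R at hsplit' ⊢
  generalize hg₀ : (#GT : ℤ) = g at sA sC hg' hdense'
  generalize hε₀ : (#ET : ℤ) = ε at sB hε' hdense'
  generalize hgW : (#(((lev m 1).powersetCard 2).filter fun Q => insert d Q ∈ W) : ℤ) = gW at hg' ⊢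
  generalize hεW : (#(((lev m 1).powersetCard 3).filter fun E => E ∈ W) : ℤ) = eW at hε' ⊢
  generalize hΓ₀ : (cH 3 (#(lev m 1) - 1) : ℤ) = Γ at ecH3' ⊢
  rw [ecH2]
  generalize hc2 : ((n.choose 2 : ℕ) : ℤ) = c2 at sA e2
  generalize hc2' : (((n - 1).choose 2 : ℕ) : ℤ) = c2' at sB sC e2' e3
  generalize hc3 : ((n.choose 3 : ℕ) : ℤ) = c3 at sB sC e3
  generalize hcH : (cH 3 n : ℤ) = cH3 at sB ecH3
  push_cast at sA sC
  generalize hnz : (n : ℤ) = nz at *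
  have hnz5 : (5 : ℤ) ≤ nz := by rw [← hnz]; exact_mod_cast hn5
  have heW : 0 ≤ eW := by rw [← hεW]; exact Nat.cast_nonneg _
  have hfin := rowOne_dense_arith hnz5 sA sB sC e2 e2' e3 ecH3 ecH3' hg' hε' heW hdense' hsplit'
  linarith [hfin]

end RowOne

end Summit.CriticalPhenomena.PercolationContinuityZ3.Theorems.SahiCTCForms
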